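import Literature.Probability.Percolation.CoveringStrictMonotonicity
import Literature.Probability.Percolation.PercolationProofs
import HarnessLib

/-!
# `p_c(𝒢) < p_c(𝒢/Γ)` from the two propositions of Martineau–Severo (2019, §4: proof of Theorem 2.1)

Assembly file of the inline proof of `Literature.Probability.Percolation.MartineauSevero2019_cor22`
(S. Martineau, F. Severo, *Strict monotonicity of percolation thresholds under covering maps*, Ann.
Probab. 47 (2019), Cor. 2.2). Martineau–Severo prove Theorem 2.1 in §4 from two propositions about
the enhanced cluster `𝒞_ℋ^{p,s}(o)` of the quotient (`EnhancedCluster.lean`: `enhCluster`, `enhEvent`):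

* **Proposition 4.1** (coupling, §5): for a suitable `r ≥ 1`, for every `ε > 0` there is `s ∈ (0,1)`
  such that for every `p ∈ [ε, 1]`, `𝒞_ℋ^{p,s}(o)` is stochastically dominated by `π(𝒞_𝒢^p(o'))`;
* **Proposition 4.2** (essential enhancement, §6): if `p_c(ℋ) < 1` then for every `s ∈ (0,1]` there
  is `p_s < p_c(ℋ)` such that for every `p ∈ [p_s, 1]`, `𝒞_ℋ^{p,s}(o)` is infinite with positive
  probability;

and conclude (§4): "if `p_c(ℋ) = 1`, then the conclusion holds trivially … Since boundedness of the
degree of `ℋ` implies that `p_c(ℋ) > 0`, we can pick some `ε` in `(0, p_c(ℋ))` … set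
`p := max(p_s, ε) < p_c(ℋ)` … `π(𝒞_𝒢^p(o'))` is infinite with positive probability … so that
`p_c(𝒢) ≤ p < p_c(ℋ)`."

This file PROVES that conclusion step (`OrbitQuotient.criticalProb_lt_of_props`) with the two
propositions as hypotheses in finite-volume form — through an abstract family of numbers
`Θ p s L` (in the application `ℙ_{p,s}(𝓔_L)`, the probability that the enhanced cluster of `o` reaches
distance `≥ L`, `EnhancedCluster.lean`) and the events `Far_L = {𝒞_𝒢^p(x) meets π⁻¹{d(o,·) ≥ L}}`
(`farEvent`) under `P_p^𝒢` — together with the ingredients of the quoted paragraph: `p_c(ℋ) > 0`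
(a hypothesis here; from the degree bound, `criticalProb_pos_of_degree_le`, in the application), the
case `p_c(ℋ) = 1`, and "`𝒞_𝒢^p(o')` is infinite with positive probability" from `P(Far_L) ≥ η` for all
large `L` by continuity from above (`theta_pos_of_farEvent`). The two hypotheses are discharged in the
sequel files (Propositions 4.1 and 4.2 for the quotient map of a free action), which then yield
`MartineauSevero2019_cor22_holds`.

## References

* S. Martineau, F. Severo, Ann. Probab. 47 (2019), §4 (Propositions 4.1, 4.2 and the proof of
  Theorem 2.1) [MartineauSevero2019].
* I. Benjamini, O. Schramm, Electron. Comm. Probab. 1 (1996), Thm. 1 [BenjaminiSchramm1996].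
-/

noncomputable section

namespace Literature.Probability.Percolation

open MeasureTheory ProbabilityTheory
open scoped ENNReal

namespace OrbitQuotient

variable {V Q : Type*}

/-! ### The far events on the cover -/

/-- **The far events on the cover**: the open cluster of `x` in `𝒢` contains a vertex whose image
lies at distance `≥ L` from `o` in `ℋ` ("`π(𝒞_𝒢^p(o'))` … in particular `𝒞_𝒢^p(o')` is infinite").
[cite: MartineauSevero2019, §4 (proof of Theorem 2.1)] -/
def farEvent (H : SimpleGraph Q) (π : V → Q) (o : Q) (x : V) (L : ℕ) : Set (BondConfig V) :=
  {ω | ∃ y, (openGraph ω).Reachable x y ∧ L ≤ H.dist o (π y)}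

/-- The far events decrease in `L`. [folklore] -/
theorem farEvent_antitone (H : SimpleGraph Q) (π : V → Q) (o : Q) (x : V) :
    Antitone (farEvent H π o x) := by
  intro L L' hLL' ω ⟨y, hy, hL'⟩
  exact ⟨y, hy, hLL'.trans hL'⟩

/-- Reaching arbitrarily far images forces an infinite open cluster. [cite: MartineauSevero2019, §4 ("𝒞_𝒢^p(o') is infinite with positive probability")] -/
theorem iInter_farEvent_subset (H : SimpleGraph Q) (π : V → Q) (o : Q) (x : V) :
    (⋂ L : ℕ, farEvent H π o x L) ⊆ percolatesAt x := by
  intro ω hω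
  rw [Set.mem_iInter] at hω
  by_contra hfin
  have hfin' : (openCluster ω x).Finite := Set.not_infinite.1 hfin
  obtain ⟨M, hM⟩ : ∃ M : ℕ, ∀ y ∈ openCluster ω x, H.dist o (π y) ≤ M := by
    obtain ⟨s, hs⟩ := hfin'.exists_finset_coe
    refine ⟨s.sup fun y => H.dist o (π y), fun y hy => ?_⟩
    have hy' : y ∈ s := by rw [← Finset.mem_coe, hs]; exact hy
    exact Finset.le_sup (f := fun y => H.dist o (π y)) hy'
  obtain ⟨y, hy, hyL⟩ := hω (M + 1)
  have := hM y hy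
  omega

/-- The far events are measurable (`V` countable). [folklore] -/
theorem measurableSet_farEvent [Countable V] (H : SimpleGraph Q) (π : V → Q) (o : Q) (x : V) (L : ℕ) :
    MeasurableSet (farEvent H π o x L) := by
  have : farEvent H π o x L = ⋃ y : V, (if L ≤ H.dist o (π y) then openConn x y else ∅) := by
    ext ω
    simp only [farEvent, Set.mem_setOf_eq, Set.mem_iUnion]
    constructor
    · rintro ⟨y, hy, hyL⟩
      exact ⟨y, by rw [if_pos hyL]; exact hy⟩
    · rintro ⟨y, hy⟩
      split_ifs at hy with h
      · exact ⟨y, hy, h⟩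
      · simp at hy
  rw [this]
  refine MeasurableSet.iUnion fun y => ?_
  split_ifs
  · exact measurableSet_openConn_holds _ _
  · exact MeasurableSet.empty

/-- **"`𝒞_𝒢^p(o')` is infinite with positive probability"**: if `P_p^𝒢(Far_L) ≥ η > 0` for every
`L`, then `θ_𝒢(x, p) ≥ η > 0` (continuity from above along the decreasing far events, whose
intersection forces an infinite cluster). [cite: MartineauSevero2019, §4 (proof of Theorem 2.1, last step)] -/
theorem theta_pos_of_farEvent [Countable V] (G : SimpleGraph V) (H : SimpleGraph Q) (π : V → Q) (o : Q)
    (x : V) (p : unitInterval) {η : ℝ} (hη : 0 < η)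
    (h : ∀ L : ℕ, η ≤ (bondPercolation G p).real (farEvent H π o x L)) : 0 < theta G x p := by
  set μ := bondPercolation G p with hμ
  have hanti := farEvent_antitone H π o x
  have hmeas : ∀ L : ℕ, NullMeasurableSet (farEvent H π o x L) μ := fun L =>
    (measurableSet_farEvent H π o x L).nullMeasurableSet
  have hiInter : μ (⋂ L : ℕ, farEvent H π o x L) = ⨅ L : ℕ, μ (farEvent H π o x L) :=
    hanti.measure_iInter hmeas ⟨0, measure_ne_top _ _⟩
  have hge : ENNReal.ofReal η ≤ μ (⋂ L : ℕ, farEvent H π o x L) := by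
    rw [hiInter]
    refine le_iInf fun L => ?_
    rw [← ofReal_measureReal (measure_ne_top _ _)]
    exact ENNReal.ofReal_le_ofReal (h L)
  have hle : μ (⋂ L : ℕ, farEvent H π o x L) ≤ μ (percolatesAt x) :=
    measure_mono (iInter_farEvent_subset H π o x)
  have : η ≤ theta G x p := by
    rw [theta, ← hμ, measureReal_def, ← ENNReal.ofReal_le_iff_le_toReal (measure_ne_top _ _)]
    exact hge.trans hle
  exact hη.trans_le this

/-- `θ_x(p) > 0` puts `p` above `p_c(G, x)`. [folklore] -/
theorem criticalProb_le_of_theta_pos (G : SimpleGraph V) (x : V) (p : unitInterval)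
    (h : 0 < theta G x p) : criticalProb G x ≤ p := by
  refine csInf_le ⟨0, ?_⟩ (Or.inl ⟨p.2, by simpa using h⟩)
  rintro q (⟨hq, -⟩ | hq)
  · exact hq.1
  · rw [Set.mem_singleton_iff] at hq
    rw [hq]; exact zero_le_one

/-! ### The conclusion of §4 from the two propositions -/

/-- **Theorem 2.1 / Corollary 2.2 from Propositions 4.1 and 4.2** (Martineau–Severo, §4, "Proof of
Theorem 2.1"). Data: a graph `𝒢` on a countable vertex type, a graph `ℋ` with `p_c(ℋ, o) > 0`
("boundedness of the degree of `ℋ` implies that `p_c(ℋ) > 0`"), a map `π`, roots `x` and `o`, the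
finite-volume enhanced percolation probabilities `Θ p s L` (`= ℙ_{p,s}(𝓔_L)`), a threshold `L₀`, and
`p_c(𝒢, x) < 1`. Hypotheses: (4.1) for every `ε > 0` there is `s > 0` with `Θ p s L ≤ P_p^𝒢(Far_L)` for
all `p ≥ ε` and all `L ≥ L₀`; (4.2) if `p_c(ℋ, o) < 1` then for every `ε ∈ (0, p_c(ℋ, o))` and every
`s > 0` there are `p ∈ [ε, p_c(ℋ, o))` and `η > 0` with `Θ p s L ≥ η` for all `L ≥ L₀`. Conclusion:
`p_c(𝒢, x) < p_c(ℋ, o)`. Proof as printed: the case `p_c(ℋ) = 1` is trivial; otherwise take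
`ε = p_c(ℋ)/2`, `s` from (4.1), `p ∈ [ε, p_c(ℋ))` and `η` from (4.2); then
`P_p^𝒢(Far_L) ≥ Θ p s L ≥ η > 0` for all `L ≥ L₀`, hence for all `L` (the far events decrease), so
`θ_𝒢(x, p) > 0` and `p_c(𝒢, x) ≤ p < p_c(ℋ, o)`.
[cite: MartineauSevero2019, §4 (proof of Theorem 2.1 from Propositions 4.1 and 4.2)] -/
theorem criticalProb_lt_of_props [Countable V] (G : SimpleGraph V) (H : SimpleGraph Q) (π : V → Q)
    (x : V) (o : Q) (Θ : unitInterval → unitInterval → ℕ → ℝ) (L₀ : ℕ)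
    (hpc : criticalProb G x < 1) (hpcH : 0 < criticalProb H o)
    (h41 : ∀ ε : ℝ, 0 < ε → ∃ s : unitInterval, 0 < (s : ℝ) ∧ ∀ p : unitInterval, ε ≤ (p : ℝ) →
      ∀ L : ℕ, L₀ ≤ L → Θ p s L ≤ (bondPercolation G p).real (farEvent H π o x L))
    (h42 : criticalProb H o < 1 → ∀ ε : ℝ, 0 < ε → ε < criticalProb H o →
      ∀ s : unitInterval, 0 < (s : ℝ) → ∃ p : unitInterval, ε ≤ (p : ℝ) ∧ (p : ℝ) < criticalProb H o ∧
        ∃ η : ℝ, 0 < η ∧ ∀ L : ℕ, L₀ ≤ L → η ≤ Θ p s L) :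
    criticalProb G x < criticalProb H o := by
  set pcH : ℝ := criticalProb H o with hpcH'
  have hpcH1 : pcH ≤ 1 := (criticalProb_mem_Icc H o).2
  rcases hpcH1.lt_or_eq with hlt | heq
  · -- `0 < p_c(ℋ) < 1`: `ε = p_c(ℋ)/2`
    obtain ⟨s, hs, h41s⟩ := h41 (pcH / 2) (by linarith)
    obtain ⟨p, hεp, hplt, η, hη, hηL⟩ := h42 hlt (pcH / 2) (by linarith) (by linarith) s hs
    -- `P_p^𝒢(Far_L) ≥ η` for `L ≥ L₀`, hence for all `L`
    have hchain : ∀ L : ℕ, η ≤ (bondPercolation G p).real (farEvent H π o x L) := by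
      intro L
      have hL : η ≤ (bondPercolation G p).real (farEvent H π o x (max L L₀)) :=
        (hηL (max L L₀) (le_max_right _ _)).trans (h41s p hεp (max L L₀) (le_max_right _ _))
      exact hL.trans (measureReal_mono (farEvent_antitone H π o x (le_max_left L L₀)))
    have hθ : 0 < theta G x p := theta_pos_of_farEvent G H π o x p hη hchain
    exact (criticalProb_le_of_theta_pos G x p hθ).trans_lt hplt
  · -- `p_c(ℋ) = 1`
    rw [heq]
    exact hpc

end OrbitQuotient

end Literature.Probability.Percolation
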